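import Mathlib.Analysis.Matrix.Order
import Summits.Ventures.CertifiedManyBodySolver.Conjectures.OneBodySection
import Summits.Ventures.CertifiedManyBodySolver.Conjectures.RingSaturationSums

/-!
# Ring saturation one site early (T-M1D.26), part 2/3: the certificate and its pairing identity

HONEST FRAMING: first certified bounds; not a superconductivity verdict; every number certified
or labelled float.  (Venture `CertifiedManyBodySolver`, programme `hubbard-alg`, team M1 seat 4,
structure notes `STRUCTURE-TM1-doped.md` entry T-M1D.26; proof of record with the discovery path
`structure/ringsat/RING-SAT-THEOREM.md`; setting and notation of `OneBodySection.lean`.)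

With the bond data of part 1 (`RingSaturationSums.lean`): bond vector on the window sites
`s = x + 1 ∈ [1, L−1]`, `v_n(x) = e^{i(x+1)θ_n}(1 − ω^{x+1}) = χ_n − χ_{n+1}` (the momentum-space
difference kills the deleted site `s = 0`), weight `λ = 2/(L²cos(π/L))`, `P_n = Re(v_n v_n†)`
(real PSD), `S = Σ_n max(−λG_n,0)·P_n ⪰ 0`, `R = Σ_n max(λG_n,0)·P_n ⪰ 0` — PSD BY INSPECTION —
and `S − R = Σ_n (−λG_n)·P_n`.  The main result of this file is the PAIRING IDENTITY, valid for
every one-body sequence `g`: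

  `tr((S − R)·T_{L−1}(g)) = −(4cos(πN/L)/cos(π/L))·g 0 + 4·g 1`   (`pairing`).

Proof: the bond-summed kernel is `Σ_n(−λG_n)(p p + q q)(x,y) = Re(−λ a_{x+1} ā_{y+1} c(x − y))`
(`kernel_entry`; `a_s = 1 − ω^s`, `c` the bond symbol), `c` is supported on `|m| ≤ 1`, so the
double sum collapses to the tridiagonal (`sum_sum_tridiag`), where the window sums `Σ|a_s|² = 2L`
and `Σ a_{s+1}ā_s = L(1 + ω)` of part 1 evaluate the diagonal (`Fker_diag`, coefficient
`−λ·2L²cos(πN/L) = −4cos(πN/L)/cos(π/L)` of `g 0` — the structure datum C-M1D-18) and the two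
off-diagonals (`Fker_offdiag`, coefficient `4` of `g 1`).
-/

namespace Summit.Ventures.CertifiedManyBodySolver.Conjectures.RingSaturation

open Complex Finset
open scoped Real

variable (L N : ℕ)

/-! ## A double sum supported on the tridiagonal -/

/-- A double sum over a square whose summand vanishes off the tridiagonal `|x − y| ≤ 1` collapses to the diagonal and the two off-diagonals. -/
theorem sum_sum_tridiag {α : Type*} [AddCommMonoid α] (F : ℕ → ℕ → α) :
    ∀ n : ℕ, (∀ x y, x ≤ n → y ≤ n → (x + 2 ≤ y ∨ y + 2 ≤ x) → F x y = 0) →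
      ∑ x ∈ range (n + 1), ∑ y ∈ range (n + 1), F x y
        = ∑ x ∈ range (n + 1), F x x + ∑ x ∈ range n, (F (x + 1) x + F x (x + 1))
  | 0, _ => by simp
  | n + 1, hF => by
      have IH := sum_sum_tridiag F n (fun x y hx hy h => hF x y (by omega) (by omega) h)
      rw [Finset.sum_range_succ (fun x => ∑ y ∈ range (n + 1 + 1), F x y)]
      have hcol : ∀ x ∈ range (n + 1), ∑ y ∈ range (n + 1 + 1), F x y
          = ∑ y ∈ range (n + 1), F x y + F x (n + 1) := fun x _ => Finset.sum_range_succ _ _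
      rw [Finset.sum_congr rfl hcol, Finset.sum_add_distrib, IH]
      have hlast : ∑ x ∈ range (n + 1), F x (n + 1) = F n (n + 1) := by
        rw [Finset.sum_range_succ, Finset.sum_eq_zero (fun x hx => ?_), zero_add]
        simp only [mem_range] at hx
        exact hF x (n + 1) (by omega) le_rfl (Or.inl (by omega))
      have hrow : ∑ y ∈ range (n + 1 + 1), F (n + 1) y = F (n + 1) n + F (n + 1) (n + 1) := by
        rw [Finset.sum_range_succ, Finset.sum_range_succ, Finset.sum_eq_zero (fun y hy => ?_),
          zero_add]
        simp only [mem_range] at hy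
        exact hF (n + 1) y le_rfl (by omega) (Or.inr (by omega))
      rw [hlast, hrow, Finset.sum_range_succ (fun x => F x x) (n + 1),
        Finset.sum_range_succ (fun x => F (x + 1) x + F x (x + 1)) n]
      abel

/-- Double sums over `Fin S` as double sums over `range S`. -/
theorem sum_fin_fin (S : ℕ) (F : ℕ → ℕ → ℝ) :
    (∑ x : Fin S, ∑ y : Fin S, F x y) = ∑ x ∈ range S, ∑ y ∈ range S, F x y := by
  simp only [Finset.sum_range]

/-! ## The real certificate matrices -/

/-- The certificate weight `λ = 2/(L² cos(π/L))`. -/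
noncomputable def lam : ℝ := 2 / ((L : ℝ) ^ 2 * Real.cos (π / L))

/-- The weight `λ` is positive for `L ≥ 3`. -/
theorem lam_pos (hL : 3 ≤ L) : 0 < lam L := by
  unfold lam
  have := cos_pi_div_pos L hL
  have hL' : (0 : ℝ) < L := by exact_mod_cast (show 0 < L by omega)
  positivity

/-- The complex bond vector on the `L − 1` window sites `s = x + 1`:
`v_n(x) = e^{i(x+1)θ_n}(1 − ω^{x+1}) = χ_n(x+1) − χ_{n+1}(x+1)`. -/
noncomputable def v (n : ℕ) (x : Fin (L - 1)) : ℂ :=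
  cexp ((((x : ℕ) + 1 : ℕ) : ℂ) * θ L N n * I) * siteFac L ((x : ℕ) + 1)

/-- Real and imaginary parts of the bond vectors. -/
noncomputable def p (n : ℕ) (x : Fin (L - 1)) : ℝ := (v L N n x).re
/-- Imaginary part of the bond vector. -/
noncomputable def q (n : ℕ) (x : Fin (L - 1)) : ℝ := (v L N n x).im

/-- `P_n = Re(v_n v_n†) = p_n p_nᵀ + q_n q_nᵀ`. -/
noncomputable def P (n : ℕ) : Matrix (Fin (L - 1)) (Fin (L - 1)) ℝ :=
  Matrix.vecMulVec (p L N n) (p L N n) + Matrix.vecMulVec (q L N n) (q L N n)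

/-- `P_n ⪰ 0` (a sum of two real rank-one squares). -/
theorem P_posSemidef (n : ℕ) : (P L N n).PosSemidef := by
  unfold P
  have h1 := Matrix.posSemidef_vecMulVec_self_star (p L N n)
  have h2 := Matrix.posSemidef_vecMulVec_self_star (q L N n)
  rw [star_trivial] at h1 h2
  exact h1.add h2

/-- `S = Σ_n max(−λG_n, 0)·P_n` (the occupied bonds) and `R = Σ_n max(λG_n, 0)·P_n`
(the unoccupied bonds). -/
noncomputable def Smat : Matrix (Fin (L - 1)) (Fin (L - 1)) ℝ :=
  ∑ n ∈ range L, max (-(lam L * G L N n)) 0 • P L N n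
/-- The unoccupied-bond certificate `R = Σ_n max(λG_n, 0)·P_n`. -/
noncomputable def Rmat : Matrix (Fin (L - 1)) (Fin (L - 1)) ℝ :=
  ∑ n ∈ range L, max (lam L * G L N n) 0 • P L N n

/-- `S ⪰ 0` by inspection: non-negative weights on PSD `P_n`. -/
theorem Smat_posSemidef : (Smat L N).PosSemidef :=
  Matrix.posSemidef_sum _ fun n _ => (P_posSemidef L N n).smul (le_max_right _ _)

/-- `R ⪰ 0` by inspection: non-negative weights on PSD `P_n`. -/
theorem Rmat_posSemidef : (Rmat L N).PosSemidef :=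
  Matrix.posSemidef_sum _ fun n _ => (P_posSemidef L N n).smul (le_max_right _ _)

/-- `S − R = Σ_n (−λG_n)·P_n` (`max(a,0) − max(−a,0) = a`). -/
theorem Smat_sub_Rmat : Smat L N - Rmat L N = ∑ n ∈ range L, (-(lam L * G L N n)) • P L N n := by
  unfold Smat Rmat
  rw [← Finset.sum_sub_distrib]
  refine Finset.sum_congr rfl fun n _ => ?_
  rw [← sub_smul]
  congr 1
  have := max_zero_sub_max_neg_zero_eq_self (-(lam L * G L N n))
  rw [neg_neg] at this
  exact this

/-! ## The pairing with a section -/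

/-- `tr(a bᵀ · T) = Σ_{x,y} a_x b_y T_{yx}`. -/
theorem trace_vecMulVec_mul {S : ℕ} (a b : Fin S → ℝ) (T : Matrix (Fin S) (Fin S) ℝ) :
    (Matrix.vecMulVec a b * T).trace = ∑ x, ∑ y, a x * b y * T y x := by
  simp only [Matrix.trace, Matrix.diag_apply, Matrix.mul_apply, Matrix.vecMulVec_apply]

/-- `p_n(x)p_n(y) + q_n(x)q_n(y) = Re(v_n(x) conj v_n(y))`. -/
theorem pq_eq_re (n : ℕ) (x y : Fin (L - 1)) :
    p L N n x * p L N n y + q L N n x * q L N n y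
      = (v L N n x * (starRingEnd ℂ) (v L N n y)).re := by
  simp [p, q, Complex.mul_re, Complex.conj_re, Complex.conj_im]

/-- `v_n(x) conj v_n(y) = a_{x+1} conj(a_{y+1}) e^{i(x−y)θ_n}`. -/
theorem v_mul_conj (n : ℕ) (x y : Fin (L - 1)) :
    v L N n x * (starRingEnd ℂ) (v L N n y)
      = siteFac L ((x : ℕ) + 1) * (starRingEnd ℂ) (siteFac L ((y : ℕ) + 1))
        * cexp ((((x : ℕ) : ℤ) - ((y : ℕ) : ℤ) : ℤ) * θ L N n * I) := by
  unfold v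
  rw [map_mul]
  have hc : (starRingEnd ℂ) (cexp ((((y : ℕ) + 1 : ℕ) : ℂ) * θ L N n * I))
      = cexp (-((((y : ℕ) + 1 : ℕ) : ℂ) * θ L N n * I)) := by
    have h := conj_cexp_mul_I ((((y : ℕ) + 1 : ℕ) : ℝ) * θ L N n)
    push_cast at h ⊢
    exact h
  rw [hc]
  have he : cexp ((((x : ℕ) + 1 : ℕ) : ℂ) * θ L N n * I) * cexp (-((((y : ℕ) + 1 : ℕ) : ℂ) * θ L N n * I))
      = cexp ((((x : ℕ) : ℤ) - ((y : ℕ) : ℤ) : ℤ) * θ L N n * I) := by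
    rw [← Complex.exp_add]; congr 1; push_cast; ring
  rw [← he]; ring

/-- The bond-summed kernel: `Σ_n (−λG_n)(p p + q q)(x,y) = Re(−λ a_{x+1} ā_{y+1} c(x − y))`. -/
theorem kernel_entry (x y : Fin (L - 1)) :
    ∑ n ∈ range L, (-(lam L * G L N n)) * (p L N n x * p L N n y + q L N n x * q L N n y)
      = (-(lam L : ℂ) * (siteFac L ((x : ℕ) + 1) * (starRingEnd ℂ) (siteFac L ((y : ℕ) + 1))
          * bondSum L N (((x : ℕ) : ℤ) - ((y : ℕ) : ℤ)))).re := by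
  simp_rw [pq_eq_re, v_mul_conj]
  unfold bondSum
  rw [Finset.mul_sum, Finset.mul_sum, Complex.re_sum]
  refine Finset.sum_congr rfl fun n _ => ?_
  rw [← Complex.re_ofReal_mul]
  congr 1
  push_cast
  ring


/-- `tr((S − R)·T) = Σ_{x,y} T_{yx} · Σ_n (−λG_n)(p p + q q)(x, y)` for any matrix `T`. -/
theorem trace_SR_mul (T : Matrix (Fin (L - 1)) (Fin (L - 1)) ℝ) :
    ((Smat L N - Rmat L N) * T).trace
      = ∑ x, ∑ y, T y x * ∑ n ∈ range L,
          (-(lam L * G L N n)) * (p L N n x * p L N n y + q L N n x * q L N n y) := by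
  rw [Smat_sub_Rmat, Finset.sum_mul, Matrix.trace_sum]
  have h1 : ∀ n ∈ range L, ((-(lam L * G L N n)) • P L N n * T).trace
      = ∑ x, ∑ y, T y x * ((-(lam L * G L N n))
          * (p L N n x * p L N n y + q L N n x * q L N n y)) := by
    intro n _
    rw [Matrix.smul_mul, Matrix.trace_smul, P, Matrix.add_mul, Matrix.trace_add,
      trace_vecMulVec_mul, trace_vecMulVec_mul, smul_eq_mul, ← Finset.sum_add_distrib,
      Finset.mul_sum]
    refine Finset.sum_congr rfl fun x _ => ?_
    rw [← Finset.sum_add_distrib, Finset.mul_sum]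
    refine Finset.sum_congr rfl fun y _ => ?_
    ring
  rw [Finset.sum_congr rfl h1, Finset.sum_comm]
  refine Finset.sum_congr rfl fun x _ => ?_
  rw [Finset.sum_comm]
  refine Finset.sum_congr rfl fun y _ => ?_
  rw [Finset.mul_sum]

/-- The collapsed kernel `F(x,y) = g|x−y| · Re(−λ a_{x+1} ā_{y+1} c(x−y))` on site labels. -/
noncomputable def Fker (g : ℕ → ℝ) (x y : ℕ) : ℝ :=
  g ((y - x) + (x - y)) * (-(lam L : ℂ) * (siteFac L (x + 1) * (starRingEnd ℂ) (siteFac L (y + 1))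
    * bondSum L N ((x : ℤ) - (y : ℤ)))).re

/-- The pairing as a double sum of the collapsed kernel over site labels. -/
theorem trace_eq_sum_Fker (g : ℕ → ℝ) :
    ((Smat L N - Rmat L N) * toeplitzSection (L - 1) g).trace
      = ∑ x ∈ range (L - 1), ∑ y ∈ range (L - 1), Fker L N g x y := by
  rw [trace_SR_mul, ← sum_fin_fin]
  refine Finset.sum_congr rfl fun x _ => Finset.sum_congr rfl fun y _ => ?_
  rw [kernel_entry]
  simp only [Fker, toeplitzSection, Matrix.of_apply]

/-- Far from the diagonal the kernel vanishes (`c(m) = 0` for `2 ≤ |m| ≤ L − 2`). -/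
theorem Fker_far (g : ℕ → ℝ) {x y : ℕ} (hx : x ≤ L - 2) (hy : y ≤ L - 2)
    (h : x + 2 ≤ y ∨ y + 2 ≤ x) : Fker L N g x y = 0 := by
  unfold Fker
  rcases h with h | h
  · have hm : ((x : ℤ) - (y : ℤ)) = -(((y : ℤ) - (x : ℤ))) := by ring
    rw [hm, bondSum_neg_eq_zero L N (m := (y : ℤ) - x) (by omega) (by omega)]
    simp
  · rw [bondSum_eq_zero L N (m := (x : ℤ) - y) (by omega) (by omega)]
    simp

/-- The diagonal: `Σ_x F(x,x) = −λ·2L²·cos(πN/L)·g 0`. -/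
theorem Fker_diag (hL : 3 ≤ L) (g : ℕ → ℝ) :
    ∑ x ∈ range (L - 1), Fker L N g x x = -(lam L * (2 * L ^ 2 * Real.cos (π * N / L))) * g 0 := by
  have key : ∀ x : ℕ, Fker L N g x x = g 0 * (-(lam L * (L * Real.cos (π * N / L))))
      * (siteFac L (x + 1) * (starRingEnd ℂ) (siteFac L (x + 1))).re := by
    intro x
    unfold Fker
    rw [Nat.sub_self, add_zero, sub_self, bondSum_zero L N (by omega)]
    have : -(lam L : ℂ) * (siteFac L (x + 1) * (starRingEnd ℂ) (siteFac L (x + 1))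
        * ((L : ℂ) * ((Real.cos (π * N / L) : ℝ) : ℂ)))
        = ((-(lam L * (L * Real.cos (π * N / L))) : ℝ) : ℂ)
          * (siteFac L (x + 1) * (starRingEnd ℂ) (siteFac L (x + 1))) := by
      push_cast; ring
    rw [this, Complex.re_ofReal_mul]
    ring
  simp_rw [key]
  rw [← Finset.mul_sum, ← Complex.re_sum, windowSum_zero L (by omega)]
  have : ((2 : ℂ) * L).re = 2 * L := by simp
  rw [this]
  ring

/-- conj of the window sum `W₁`. -/
theorem windowSum_one_conj (hL : 3 ≤ L) :
    ∑ x ∈ range (L - 2), siteFac L (x + 1) * (starRingEnd ℂ) (siteFac L (x + 2))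
      = L * (1 + cexp (-((2 * π / L) * I))) := by
  have h := congrArg (starRingEnd ℂ) (windowSum_one L hL)
  rw [map_sum] at h
  have h2 : (starRingEnd ℂ) ((L : ℂ) * (1 + cexp ((2 * π / L) * I)))
      = L * (1 + cexp (-((2 * π / L) * I))) := by
    rw [map_mul, map_add, map_one, Complex.conj_natCast]
    have := conj_cexp_mul_I (2 * π / L)
    push_cast at this
    rw [this]
  rw [h2] at h
  rw [← h]
  refine Finset.sum_congr rfl fun x _ => ?_
  rw [map_mul, Complex.conj_conj, mul_comm]

/-- The two off-diagonals: `Σ_x (F(x+1,x) + F(x,x+1)) = 4·g 1`. -/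
theorem Fker_offdiag (hL : 3 ≤ L) (g : ℕ → ℝ) :
    ∑ x ∈ range (L - 2), (Fker L N g (x + 1) x + Fker L N g x (x + 1)) = 4 * g 1 := by
  have k1 : ∀ x : ℕ, Fker L N g (x + 1) x
      = g 1 * (-(lam L : ℂ) * bondSum L N 1
          * (siteFac L (x + 2) * (starRingEnd ℂ) (siteFac L (x + 1)))).re := by
    intro x
    unfold Fker
    have e1 : (x - (x + 1)) + ((x + 1) - x) = 1 := by omega
    have e2 : (((x + 1 : ℕ) : ℤ) - (x : ℤ)) = 1 := by push_cast; ring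
    rw [e1, e2]
    congr 2
    ring
  have k2 : ∀ x : ℕ, Fker L N g x (x + 1)
      = g 1 * (-(lam L : ℂ) * bondSum L N (-1)
          * (siteFac L (x + 1) * (starRingEnd ℂ) (siteFac L (x + 2)))).re := by
    intro x
    unfold Fker
    have e1 : ((x + 1) - x) + (x - (x + 1)) = 1 := by omega
    have e2 : ((x : ℤ) - ((x + 1 : ℕ) : ℤ)) = -1 := by push_cast; ring
    rw [e1, e2]
    congr 2
    ring
  simp_rw [k1, k2]
  rw [Finset.sum_add_distrib, ← Finset.mul_sum, ← Finset.mul_sum, ← Complex.re_sum,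
    ← Complex.re_sum, ← Finset.mul_sum, ← Finset.mul_sum, windowSum_one L hL,
    windowSum_one_conj L hL, bondSum_one L N hL, bondSum_neg_one L N hL, ← mul_add,
    ← Complex.add_re]
  -- the complex number in brackets is real: −2L²cos(π/L)
  have hω1 : cexp (-(π / L * I)) * cexp ((2 * π / L) * I) = cexp (π / L * I) := by
    rw [← Complex.exp_add]; congr 1; ring
  have hω2 : cexp (π / L * I) * cexp (-((2 * π / L) * I)) = cexp (-(π / L * I)) := by
    rw [← Complex.exp_add]; congr 1; ring
  have hcos : cexp (π / L * I) + cexp (-(π / L * I)) = ((2 * Real.cos (π / L) : ℝ) : ℂ) := by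
    push_cast
    rw [Complex.two_cos, neg_mul]
  have hZ : -(L / 2 : ℂ) * cexp (-(π / L * I)) * (L * (1 + cexp ((2 * π / L) * I)))
      + -(L / 2 : ℂ) * cexp (π / L * I) * (L * (1 + cexp (-((2 * π / L) * I))))
      = (((-(2 * L ^ 2 * Real.cos (π / L))) : ℝ) : ℂ) := by
    have : -(L / 2 : ℂ) * cexp (-(π / L * I)) * (L * (1 + cexp ((2 * π / L) * I)))
        + -(L / 2 : ℂ) * cexp (π / L * I) * (L * (1 + cexp (-((2 * π / L) * I))))
        = -(L ^ 2 : ℂ) * (cexp (π / L * I) + cexp (-(π / L * I))) := by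
      linear_combination (-(L : ℂ) ^ 2 / 2) * hω1 + (-(L : ℂ) ^ 2 / 2) * hω2
    rw [this, hcos]; push_cast; ring
  have hZ' : -(lam L : ℂ) * (-(L / 2 : ℂ) * cexp (-(π / L * I))) * (L * (1 + cexp ((2 * π / L) * I)))
      + -(lam L : ℂ) * (-(L / 2 : ℂ) * cexp (π / L * I)) * (L * (1 + cexp (-((2 * π / L) * I))))
      = (((lam L * (2 * L ^ 2 * Real.cos (π / L))) : ℝ) : ℂ) := by
    push_cast at hZ ⊢
    linear_combination (-(lam L : ℂ)) * hZ
  rw [hZ', Complex.ofReal_re]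
  unfold lam
  have hc := cos_pi_div_pos L hL
  have hL' : (0 : ℝ) < L := by exact_mod_cast (show 0 < L by omega)
  field_simp
  ring

/-- **The pairing identity of the certificate**: for every one-body sequence `g`,
`tr((S − R)·T_{L−1}(g)) = −(4cos(πN/L)/cos(π/L))·g 0 + 4·g 1`. -/
theorem pairing (hL : 3 ≤ L) (g : ℕ → ℝ) :
    ((Smat L N - Rmat L N) * toeplitzSection (L - 1) g).trace
      = -(4 * Real.cos (π * N / L) / Real.cos (π / L)) * g 0 + 4 * g 1 := by
  rw [trace_eq_sum_Fker]
  obtain ⟨M, hM⟩ : ∃ M, L = M + 3 := ⟨L - 3, by omega⟩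
  have hF := sum_sum_tridiag (Fker L N g) (M + 1) (fun x y hx hy h =>
    Fker_far L N g (by omega) (by omega) h)
  rw [show L - 1 = M + 1 + 1 by omega, hF]
  have hd := Fker_diag L N hL g
  have ho := Fker_offdiag L N hL g
  rw [show L - 1 = M + 1 + 1 by omega] at hd
  rw [show L - 2 = M + 1 by omega] at ho
  rw [hd, ho]
  unfold lam
  have hc := cos_pi_div_pos L hL
  have hL' : (0 : ℝ) < L := by exact_mod_cast (show 0 < L by omega)
  field_simp
  ring


end Summit.Ventures.CertifiedManyBodySolver.Conjectures.RingSaturation
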